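import Mathlib
import Summits.NavierStokesRegularity.NavierStokesRegularity.Theorems.WakeRatchetTailRatchetDSS
import HarnessLib

/-!
# `WakeRatchet.TailRatchet` (stmt-NavierStokesRegularity-21808) — the tail ratchet STALLS every
# bounded admissible eternal solution; kill criterion by PERSISTENT FIRING (no self-similarity needed)

Support lemmas for the aside crux `TailRatchet` (route `WakeRatchet`; MODEL lattice ODEs of Tao 2016 §4 in
the renormalised variables of §6.4 — nothing here is a statement about the Navier–Stokes equations, and
stmt-21808 is neither proved nor refuted here).

THE OBSERVATION.  The tree reads `TailRatchet` as a Liouville theorem on two strata: the self-similar one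
(`WakeRatchetTailRatchetDSS.no_dssWave_of_tailRatchet`: no admissible DSS wave below threshold) and the
finite-energy one (`WakeRatchetTailRatchetLive.finiteEnergy_liouville_of_tailRatchet`).  This file records the
reading that needs NEITHER self-similarity NOR finite energy:

* `stall_of_contraction`: on a cancelling table, if the tail envelopes of ONE uniformly bounded admissible
  eternal solution `W` (any covariant viscosity `ν̂ ≥ 0`) contract per shell by a factor `1 − w ≥ 0` with
  `(1+ε₀)⁵(1 − w) < 1`, then for every level `c > 0`, every base shell `n₀` and every log-time `σ₀` only
  FINITELY MANY forward shells `n₀ + j` ever reach renormalised amplitude `‖W_{n₀+j}(σ)‖ ≥ c` at a log-time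
  `σ ≥ σ₀` — the cascade STALLS.  (Proof: `Θ_{n₀} < ∞` by `TailEnvelopeFinite.main`; iterating the
  contraction, `Θ_{n₀+j} ≤ (1−w)^j Θ_{n₀}` (`tail_le_pow_from`); a firing at `σ ≥ σ₀` gives
  `Θ_{n₀+j} ≥ E_{n₀+j}(σ) ≥ Λ^{-2(n₀+j)} e^{2σ₀} c²`; hence `Λ^{-2n₀}e^{2σ₀}c² ≤ ((1+ε₀)⁵(1−w))^j Θ_{n₀} → 0`.)
* `stall_of_tailRatchet`: `TailRatchet` ⟹ below a threshold `ε₁(R) > 0`, EVERY uniformly bounded admissible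
  eternal solution of every E₂(R) table stalls in this sense.
* KILL CRITERION `tailRatchet_false_of_persistentFiring`: a uniformly bounded admissible eternal solution of
  an E₂(R) table at arbitrarily small scale ratio in which infinitely many forward shells `n₀ + j` reach a
  fixed level `c` at log-times `≥ σ₀` (PERSISTENT FIRING) refutes `TailRatchet`.  Every shell-self-similar
  solution with a non-negative lag fires persistently (`persistentFiring_of_shellSelfSimilar`), so this
  contains the DSS kill criteria of `Theorems/WakeRatchetTailRatchet/Negative/…`; but persistent firing is
  exactly what a compactness limit of a blow-up solution recentred at its firing times inherits, with no
  self-similarity.  INTENDED USE (door "D4′", NOT proved here): for the non-negative dyadic Cauchy blow-up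
  `Ẋ_n = Λ^{n-1}X_{n-1}² − Λ^n X_n X_{n+1}` at `Λ = (1+ε₀)^{5/2}`, the two a-priori estimates
  (D) `X_n(t) ≤ D·Λ^{-n}/(t* − t_n)` for all `t`, `t_n` the first time `Λ^{n+1}(t*−t)X_n(t) ≥ 1`, and
  (M) `Λ^n ∫_0^{t*} X_n dt ≤ M`, uniformly in `n`, give (lower blow-up rate + the elementary firing-order
  lemma `t_{n+1} ≥ t_n` + post-firing decay) firing-gap bounds `s_{n+k} − s_n ≤ k·log(DΛ)` in log-time, and
  the frames recentred at the firing log-times `s_n` converge (Arzelà–Ascoli, as in the tree's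
  `WakeRatchetExtraction*` / `QuietPastAlphaLimit`) to a uniformly bounded admissible eternal solution with
  persistent firing at level `1/Λ` — so (D) + (M) + blow-up would refute `TailRatchet` through this file.
  Neither (D) nor (M) is in print (Katz–Pavlović 2005, Kiselev–Zlatoš 2005, Cheskidov–Friedlander–Pavlović
  2010 give blow-up, not these rates).

HONEST FRAMING: bookkeeping about bounded eternal solutions of Tao-type MODEL lattice ODEs; the kill
criterion is a conditional refutation; no item is closed and no verdict changes.
-/

noncomputable section

set_option linter.dupNamespace false

namespace Summit.NavierStokesRegularity.NavierStokesRegularity.Theorems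

namespace WakeRatchetStall

open Filter Topology
open Literature.Analysis.FluidPDE Literature.Analysis.FluidPDE.TaoCascade
open WakeRatchetTail WakeRatchetDSS
open Summit.NavierStokesRegularity.NavierStokesRegularity.Theses.WakeRatchet

variable {m : ℕ} {ε₀ νh : ℝ} {α : Fin m → Fin m → Fin m → ℤ × ℤ × ℤ → ℝ} {W : ℤ → ℝ → Em m}

/-! ## A strict threshold and the firing lower bound -/

/-- STRICT threshold: `(1+ε₀)⁵(1 − w) < 1` whenever `w > 0` and `0 ≤ ε₀ ≤ w/10`
(from `1 + x ≤ eˣ`: the product is at most `e^{5ε₀ − w} ≤ e^{−w/2} < 1`; a factor `1 − w ≤ 0` is trivial).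
[folklore] -/
theorem pow_five_mul_sub_lt_one {w : ℝ} (hw : 0 < w) (hε0 : 0 ≤ ε₀) (hεw : ε₀ ≤ w / 10) :
    (1 + ε₀) ^ 5 * (1 - w) < 1 := by
  by_cases hw1 : 1 - w ≤ 0
  · have hp : 0 ≤ (1 + ε₀) ^ 5 := by positivity
    have : (1 + ε₀) ^ 5 * (1 - w) ≤ 0 := mul_nonpos_iff.2 (Or.inl ⟨hp, hw1⟩)
    linarith
  · rw [not_le] at hw1
    have h1 : (1 + ε₀) ^ 5 ≤ Real.exp (5 * ε₀) := by
      have h : 1 + ε₀ ≤ Real.exp ε₀ := by linarith [Real.add_one_le_exp ε₀]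
      calc (1 + ε₀) ^ 5 ≤ Real.exp ε₀ ^ 5 := pow_le_pow_left₀ (by linarith) h 5
        _ = Real.exp (5 * ε₀) := by rw [← Real.exp_nat_mul]; norm_num
    have h2 : 1 - w ≤ Real.exp (-w) := by linarith [Real.add_one_le_exp (-w)]
    calc (1 + ε₀) ^ 5 * (1 - w) ≤ Real.exp (5 * ε₀) * Real.exp (-w) :=
          mul_le_mul h1 h2 hw1.le (Real.exp_pos _).le
      _ = Real.exp (5 * ε₀ - w) := by rw [← Real.exp_add]; ring_nf
      _ < Real.exp 0 := Real.exp_lt_exp.2 (by linarith)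
      _ = 1 := Real.exp_zero

/-- FIRING LOWER BOUND: a shell `k` at renormalised amplitude `‖W_k(σ)‖ ≥ c ≥ 0` at a log-time `σ ≥ σ₀`
holds physical energy `E_k(σ) ≥ Λ^{-2k} e^{2σ₀} c²`.
[cite: Tao2016AveragedNS, §4 Lemma 4.1 (4.10) in the self-similar variables of §6.4; elementary] -/
theorem physEnergy_ge_of_fire (hε : 0 < ε₀) {k : ℤ} {σ σ₀ c : ℝ} (hc0 : 0 ≤ c)
    (hσ : σ₀ ≤ σ) (hfire : c ≤ ‖W k σ‖) :
    (bigLam ε₀ ^ k)⁻¹ ^ 2 * (Real.exp (2 * σ₀) * c ^ 2) ≤ physEnergy ε₀ W k σ := by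
  unfold physEnergy
  have hb : 0 < bigLam ε₀ := bigLam_pos (by linarith)
  have h1 : Real.exp (2 * σ₀) ≤ Real.exp (2 * σ) := Real.exp_le_exp.2 (by linarith)
  have h2 : c ^ 2 ≤ ‖W k σ‖ ^ 2 := pow_le_pow_left₀ hc0 hfire 2
  have h3 : 0 ≤ (bigLam ε₀ ^ k)⁻¹ ^ 2 := by positivity
  exact mul_le_mul_of_nonneg_left (mul_le_mul h1 h2 (by positivity) (Real.exp_pos _).le) h3

/-! ## Contraction stalls the cascade -/

/-- **The tail ratchet stalls every bounded admissible eternal solution.**  On a cancelling table, let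
`W` be a uniformly bounded admissible eternal solution (covariant viscosity `ν̂ ≥ 0`) whose tail envelopes
contract per shell by `1 − w ≥ 0` (the conclusion of `TailRatchet` for this `W`), with
`(1+ε₀)⁵(1 − w) < 1`.  Then for every level `c > 0`, base shell `n₀` and log-time `σ₀` there is `K` such
that NO shell `n₀ + j`, `j ≥ K`, reaches `‖W_{n₀+j}(σ)‖ ≥ c` at any `σ ≥ σ₀`: only finitely many forward
shells ever fire at level `c` after `σ₀`.  (No self-similarity and no finite-energy hypothesis.)
[cite: Tao2016AveragedNS, §4 Thm. 4.2 (statement shape), Lemma 4.1 (4.8)–(4.10), §6.4; cell vocabulary] -/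
theorem stall_of_contraction (hε : 0 < ε₀) (hc : IsCancellingCoeff α) (hW : IsEternalVisc ε₀ νh α W)
    (hU : UniformBound W) {w : ℝ} (hw0 : 0 ≤ 1 - w) (hthr : (1 + ε₀) ^ 5 * (1 - w) < 1)
    (hContr : ∀ (n : ℤ) (M : ℝ), (∀ σ : ℝ, ∑' k : ℕ, physEnergy ε₀ W (n + k) σ ≤ M) →
      ∀ σ : ℝ, ∑' k : ℕ, physEnergy ε₀ W (n + 1 + k) σ ≤ (1 - w) * M)
    {c : ℝ} (hc0 : 0 < c) (n₀ : ℤ) (σ₀ : ℝ) :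
    ∃ K : ℕ, ∀ j : ℕ, K ≤ j → ∀ σ : ℝ, σ₀ ≤ σ → ‖W (n₀ + j) σ‖ < c := by
  have hb : 0 < bigLam ε₀ := bigLam_pos (by linarith)
  -- the tail envelope at the base shell is finite
  obtain ⟨M, hM⟩ := TailEnvelopeFinite.main hε hc hW hU n₀
  -- iterate the contraction up the lattice
  have hpow := tail_le_pow_from (w := w) hM hContr
  -- the contraction ratio `ρ = (1+ε₀)⁵ (1 − w) ∈ [0, 1)`
  set ρ : ℝ := (1 + ε₀) ^ 5 * (1 - w) with hρ
  have hρ0 : 0 ≤ ρ := by positivity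
  -- the firing energy scale at the base shell
  set e : ℝ := (bigLam ε₀ ^ n₀)⁻¹ ^ 2 * (Real.exp (2 * σ₀) * c ^ 2) with he
  have he0 : 0 < e := by positivity
  -- `ρ^j · M → 0`: beyond some `K` it is below `e`
  have hlim : Tendsto (fun j : ℕ => ρ ^ j * M) atTop (𝓝 (0 * M)) :=
    (tendsto_pow_atTop_nhds_zero_of_lt_one hρ0 hthr).mul_const M
  rw [zero_mul] at hlim
  obtain ⟨K, hK⟩ := Filter.eventually_atTop.1 (hlim.eventually (eventually_lt_nhds he0))
  refine ⟨K, fun j hj σ hσ => ?_⟩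
  by_contra hge
  rw [not_lt] at hge
  -- a firing shell carries energy `≥ Λ^{-2(n₀+j)} e^{2σ₀} c²`, but its tail is `≤ (1−w)^j M`
  have h1 : (bigLam ε₀ ^ (n₀ + (j : ℤ)))⁻¹ ^ 2 * (Real.exp (2 * σ₀) * c ^ 2) ≤
      physEnergy ε₀ W (n₀ + j) σ :=
    physEnergy_ge_of_fire hε hc0.le hσ hge
  have h2 : physEnergy ε₀ W (n₀ + j) σ ≤ (1 - w) ^ j * M :=
    (physEnergy_le_tail hε hU (n₀ + j) σ).trans (hpow j σ)
  have h3 : (bigLam ε₀ ^ (n₀ + (j : ℤ)))⁻¹ ^ 2 =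
      (bigLam ε₀ ^ n₀)⁻¹ ^ 2 * (((1 + ε₀) ^ 5)⁻¹) ^ j := by
    rw [zpow_add₀ hb.ne', zpow_natCast, mul_inv, mul_pow, inv_bigLam_pow_sq hε.le]
  have h4 : e * (((1 + ε₀) ^ 5)⁻¹) ^ j ≤ (1 - w) ^ j * M := by
    have h := h1.trans h2
    rw [h3] at h
    calc e * (((1 + ε₀) ^ 5)⁻¹) ^ j
        = (bigLam ε₀ ^ n₀)⁻¹ ^ 2 * (((1 + ε₀) ^ 5)⁻¹) ^ j * (Real.exp (2 * σ₀) * c ^ 2) := by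
          rw [he]; ring
      _ ≤ (1 - w) ^ j * M := h
  have hq0 : ((1 + ε₀) ^ 5 : ℝ) ≠ 0 := by positivity
  have hqj : (((1 + ε₀) ^ 5)⁻¹) ^ j * ((1 + ε₀) ^ 5) ^ j = 1 := by
    rw [← mul_pow, inv_mul_cancel₀ hq0, one_pow]
  have h5 : e ≤ ρ ^ j * M :=
    calc e = e * ((((1 + ε₀) ^ 5)⁻¹) ^ j * ((1 + ε₀) ^ 5) ^ j) := by rw [hqj, mul_one]
      _ = (e * (((1 + ε₀) ^ 5)⁻¹) ^ j) * ((1 + ε₀) ^ 5) ^ j := by ring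
      _ ≤ ((1 - w) ^ j * M) * ((1 + ε₀) ^ 5) ^ j :=
          mul_le_mul_of_nonneg_right h4 (by positivity)
      _ = ρ ^ j * M := by rw [hρ, mul_pow]; ring
  exact absurd (hK j hj) (not_lt.2 h5)

/-! ## `TailRatchet` ⟹ every bounded admissible eternal solution stalls below threshold -/

/-- **`TailRatchet` stalls every bounded admissible eternal solution below threshold.**  For every spread
`R ≥ 1` there is `ε₁ > 0` such that for `ε₀ ∈ (0, ε₁]`, on every E₂(R) table and at every covariant
viscosity `ν̂ ≥ 0`, in every uniformly bounded admissible eternal solution only finitely many forward shells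
`n₀ + j` reach any fixed level `c > 0` at log-times `σ ≥ σ₀` (any `n₀`, `σ₀`).
[cite: Tao2016AveragedNS, §4 Thm. 4.2 (statement shape), Lemma 4.1 (4.8)–(4.10), §6.4; cell vocabulary] -/
theorem stall_of_tailRatchet (h : TailRatchet) :
    ∀ R : ℝ, 1 ≤ R → ∃ ε₁ : ℝ, 0 < ε₁ ∧ ∀ ε₀ : ℝ, 0 < ε₀ → ε₀ ≤ ε₁ →
      ∀ α : Fin 4 → Fin 4 → Fin 4 → ℤ × ℤ × ℤ → ℝ, InTableClass R α →
        ∀ (νh : ℝ) (W : ℤ → ℝ → Em 4), IsEternalVisc ε₀ νh α W → UniformBound W →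
          ∀ c : ℝ, 0 < c → ∀ (n₀ : ℤ) (σ₀ : ℝ),
            ∃ K : ℕ, ∀ j : ℕ, K ≤ j → ∀ σ : ℝ, σ₀ ≤ σ → ‖W (n₀ + j) σ‖ < c := by
  intro R hR
  obtain ⟨w, hw, εs, hεs, H⟩ := h R hR
  -- shrink the rate to `w' = min w (1/2)`, so that `0 ≤ 1 − w'`
  set w' : ℝ := min w (1 / 2) with hw'
  have hw'0 : 0 < w' := lt_min hw (by norm_num)
  have hw'1 : 0 ≤ 1 - w' := by have := min_le_right w (1 / 2); linarith
  refine ⟨min εs (w' / 10), lt_min hεs (by positivity), ?_⟩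
  intro ε₀ hε₀ hle α hα νh W hW hU c hc n₀ σ₀
  have hthr : (1 + ε₀) ^ 5 * (1 - w') < 1 :=
    pow_five_mul_sub_lt_one hw'0 hε₀.le (hle.trans (min_le_right _ _))
  refine stall_of_contraction hε₀ hα.2.1 hW hU hw'1 hthr (fun n M hM σ => ?_) hc n₀ σ₀
  have hM0 : 0 ≤ M :=
    (tsum_nonneg fun k : ℕ => physEnergy_nonneg ε₀ W (n + (k : ℤ)) σ).trans (hM σ)
  have h1 := H ε₀ hε₀ (hle.trans (min_le_left _ _)) α hα νh W hW hU n M hM σ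
  exact h1.trans (mul_le_mul_of_nonneg_right (by linarith [min_le_left w (1 / 2)]) hM0)

/-! ## Kill criterion: persistent firing refutes the tail ratchet -/

/-- **Kill criterion for `TailRatchet` by PERSISTENT FIRING.**  If on some fixed spread `R ≥ 1`, at
arbitrarily small scale ratios, some E₂(R) table carries a uniformly bounded admissible eternal solution
(any covariant viscosity `ν̂ ≥ 0`) in which infinitely many forward shells `n₀ + j` reach a fixed
renormalised amplitude `c > 0` at log-times `≥ σ₀`, then `TailRatchet` fails.  (Negative lemma modulo
such a solution; compactness limits of blow-up solutions recentred at firing times have this shape.)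
[cite: Tao2016AveragedNS, §4 Thm. 4.2 (statement shape), §6.4; cell vocabulary] -/
theorem tailRatchet_false_of_persistentFiring {R : ℝ} (hR : 1 ≤ R)
    (hF : ∀ ε : ℝ, 0 < ε → ∃ ε₀ : ℝ, 0 < ε₀ ∧ ε₀ ≤ ε ∧
      ∃ α : Fin 4 → Fin 4 → Fin 4 → ℤ × ℤ × ℤ → ℝ, InTableClass R α ∧
        ∃ (νh : ℝ) (W : ℤ → ℝ → Em 4), IsEternalVisc ε₀ νh α W ∧ UniformBound W ∧
          ∃ c : ℝ, 0 < c ∧ ∃ (n₀ : ℤ) (σ₀ : ℝ),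
            ∀ K : ℕ, ∃ j : ℕ, K ≤ j ∧ ∃ σ : ℝ, σ₀ ≤ σ ∧ c ≤ ‖W (n₀ + j) σ‖) :
    ¬ TailRatchet := by
  intro h
  obtain ⟨ε₁, hε₁, H⟩ := stall_of_tailRatchet h R hR
  obtain ⟨ε₀, hε₀, hle, α, hα, νh, W, hW, hU, c, hc, n₀, σ₀, hfire⟩ := hF ε₁ hε₁
  obtain ⟨K, hK⟩ := H ε₀ hε₀ hle α hα νh W hW hU c hc n₀ σ₀
  obtain ⟨j, hj, σ, hσ, hge⟩ := hfire K
  exact absurd (hK j hj σ hσ) (not_lt.2 hge)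

/-! ## Shell-self-similar solutions fire persistently (the DSS kill criteria are a special case) -/

/-- Along a shell-self-similar family `W_{n+1}(σ) = W_n(σ − T)`, shell `n₀ + j` repeats the value
`W_{n₀}(σ₁)` at log-time `σ₁ + jT`.
[cite: Tao2016AveragedNS, §4 Lemma 4.1 (4.8); cell vocabulary (DSS ansatz)] -/
theorem shellSelfSimilar_value {T : ℝ} (hD : ∀ (n : ℤ) (σ : ℝ), W (n + 1) σ = W n (σ - T))
    (n₀ : ℤ) (σ₁ : ℝ) : ∀ j : ℕ, W (n₀ + j) (σ₁ + j * T) = W n₀ σ₁ := by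
  intro j
  induction j with
  | zero => simp
  | succ j ih =>
    have e1 : (n₀ + ((j + 1 : ℕ) : ℤ)) = n₀ + (j : ℤ) + 1 := by push_cast; ring
    have e2 : σ₁ + ((j + 1 : ℕ) : ℝ) * T - T = σ₁ + (j : ℝ) * T := by push_cast; ring
    rw [e1, hD, e2, ih]

/-- **Shell-self-similar solutions with a non-negative lag fire persistently**: if `W_{n+1}(σ) = W_n(σ−T)`,
`T ≥ 0`, and `W_{n₀}(σ₁) ≠ 0`, then infinitely many forward shells `n₀ + j` reach the level
`c = ‖W_{n₀}(σ₁)‖ > 0` at log-times `≥ σ₁` — the hypothesis shape of `tailRatchet_false_of_persistentFiring`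
(so that kill criterion contains the tree's DSS kill criteria).
[cite: Tao2016AveragedNS, §4 Lemma 4.1 (4.8); cell vocabulary (DSS ansatz)] -/
theorem persistentFiring_of_shellSelfSimilar {T : ℝ} (hT : 0 ≤ T)
    (hD : ∀ (n : ℤ) (σ : ℝ), W (n + 1) σ = W n (σ - T)) {n₀ : ℤ} {σ₁ : ℝ} (hne : W n₀ σ₁ ≠ 0) :
    0 < ‖W n₀ σ₁‖ ∧ ∀ K : ℕ, ∃ j : ℕ, K ≤ j ∧ ∃ σ : ℝ, σ₁ ≤ σ ∧ ‖W n₀ σ₁‖ ≤ ‖W (n₀ + j) σ‖ := by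
  refine ⟨norm_pos_iff.2 hne, fun K => ⟨K, le_rfl, σ₁ + K * T, ?_, ?_⟩⟩
  · have : (0 : ℝ) ≤ K * T := mul_nonneg (Nat.cast_nonneg K) hT
    linarith
  · rw [shellSelfSimilar_value hD n₀ σ₁ K]

/-- **The DSS-type kill criterion as a special case.**  Uniformly bounded admissible eternal solutions that
are shell-self-similar with a non-negative lag (`W_{n+1}(σ) = W_n(σ − T)`, `T ≥ 0`) and non-trivial, on E₂(R)
tables at arbitrarily small scale ratios (any covariant viscosity), refute `TailRatchet` — through persistent
firing, with no use of the tail identity `Θ_{n+1} = dssMu·Θ_n`.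
[cite: Tao2016AveragedNS, §4 Thm. 4.2 (statement shape), Lemma 4.1 (4.8), §6.4; cell vocabulary] -/
theorem tailRatchet_false_of_persistentShellSelfSimilar {R : ℝ} (hR : 1 ≤ R)
    (hF : ∀ ε : ℝ, 0 < ε → ∃ ε₀ : ℝ, 0 < ε₀ ∧ ε₀ ≤ ε ∧
      ∃ α : Fin 4 → Fin 4 → Fin 4 → ℤ × ℤ × ℤ → ℝ, InTableClass R α ∧
        ∃ (νh : ℝ) (W : ℤ → ℝ → Em 4) (T : ℝ), IsEternalVisc ε₀ νh α W ∧ UniformBound W ∧ 0 ≤ T ∧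
          (∀ (n : ℤ) (σ : ℝ), W (n + 1) σ = W n (σ - T)) ∧ ∃ (n₀ : ℤ) (σ₁ : ℝ), W n₀ σ₁ ≠ 0) :
    ¬ TailRatchet := by
  refine tailRatchet_false_of_persistentFiring hR fun ε hε => ?_
  obtain ⟨ε₀, hε₀, hle, α, hα, νh, W, T, hW, hU, hT, hD, n₀, σ₁, hne⟩ := hF ε hε
  obtain ⟨hc, hfire⟩ := persistentFiring_of_shellSelfSimilar hT hD hne
  exact ⟨ε₀, hε₀, hle, α, hα, νh, W, hW, hU, ‖W n₀ σ₁‖, hc, n₀, σ₁, hfire⟩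

end WakeRatchetStall

end Summit.NavierStokesRegularity.NavierStokesRegularity.Theorems

end
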